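import Literature.NumberTheory.Transcendental.NesterenkoEliminationProp47Holds
import Literature.NumberTheory.Transcendental.PhilipponCriterionProjDist
import Literature.NumberTheory.Transcendental.PhilipponCriterionRankOne
import Mathlib.RingTheory.Lasker
import Summits.Schanuel.Schanuel.Theses.DiophantineDichotomy
import Summits.Schanuel.Schanuel.Theorems.DiophantineDichotomyApproximationPropertyDefs

/-!
# Stub `pointDatum_of_clause` of line `orbit-interpolation-determinant` (stmt-Schanuel-6117)

Route `DiophantineDichotomy`, crux
`Summit.Schanuel.Schanuel.Theses.DiophantineDichotomy.ApproximationProperty` (stmt-Schanuel-6117),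
line `orbit-interpolation-determinant`, registered stub `pointDatum_of_clause` (vocabulary in
`Theorems/DiophantineDichotomyApproximationPropertyDefs.lean`) — the PER-SCALE good-orbit transfer
in every dimension `t ≥ 1`: assuming `ZeroDimDictionary` and `SharpClosestPoint`, for every
`ω ∈ ℂᵗ` and `c₁ ≥ 1` there are a boost `λ ≥ 1` and a constant `c ≥ c₁` (depending on `t, ω, c₁`
and on the constants of the two hypotheses only) such that for `Y ≥ Δ ≥ c` and ONE homogeneous
PRIME `𝔭 ⊂ ℚ[x₀, …, x_t]` of rank `1` with `deg 𝔭 ≤ (c₁Δ)ᵗ`, `h(𝔭) ≤ c₁ λY Δᵗ⁻¹`,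
`|𝔭(1:ω)| ≤ exp(−(Δ h(𝔭) + λY deg 𝔭)/c₁)` (the 0-cycle bounds at the boosted scale `(Δ, λY)`)
and the interpolation clause `H_𝔭(⌊c₁Δ⌋) = deg 𝔭`, there are a number field `K`, `β ∈ Kᵗ` and
`σ : K →+* ℂ` with `[K:ℚ] ≤ (cΔ)ᵗ`, `h_K(1:β) ≤ c Y Δᵗ⁻¹` and
`‖σ(β) − ω‖ ≤ exp(−(Δ h_K(1:β) + Y [K:ℚ])/c)` (a `PointAPAbsAt t`-datum at `(Δ, Y)`).

This is the inner mechanism of the landed stub `stub_pointAP`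
(`Theorems/DiophantineDichotomyApproximationPropertyPointAP.lean`) with the minimal primary
decomposition / Prop. 4.7 pigeonhole removed (the prime is GIVEN, `deg 𝔭 ≥ 1` by Prop. 4.4,
`Literature.Barriers.Schanuel.one_le_ideg_of_isPrime`): the transfer `SharpClosestPoint` at
`δ = ⌊c₁Δ⌋` with `ℓ` so large that `2c₁²C ≤ ℓ^{1/t}` and the boost
`λ ≥ 2c₁²C'(t+2)(log(2+‖ω‖)+1)` absorbing `C' deg 𝔭 ((δ+1)(L+1) + log(deg 𝔭 + 1))` gives a zero of
`𝔭` at projective distance `≤ exp(−(Δ h(𝔭) + Y deg 𝔭)/(2c₁ℓ))` from `(1:ω)`;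
`PhilipponMain.affine_near_of_projDist_le` and `ZeroDimDictionary` give the field `K = ℚ(b)`, the
affine point `(b₁/b₀, …, b_t/b₀)`, the embedding and the three budgets. Sources:
NesterenkoPhilippon2001 (LNM 1752) Ch. 3 §4 (Prop. 4.4, p. 38), Ch. 4 §4 (p. 61); Philippon 1986
(Publ. Math. IHÉS 64) §3.
-/

set_option linter.dupNamespace false

noncomputable section

attribute [local instance] MvPolynomial.gradedAlgebra

namespace Summit.Schanuel.Schanuel.Cruxes.ApproximationProperty.OrbitInterpolationDeterminant

open Literature.NumberTheory.Transcendental Literature.NumberTheory.Transcendental.Nesterenko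
  Literature.NumberTheory.Transcendental.PhilipponMain MvPolynomial Real

namespace PointDatum

/-- `x ≤ ℓ^{1/t}` once `ℓ ≥ ⌈xᵗ⌉` (`x ≥ 0`, `t ≥ 1`). [folklore] -/
theorem le_rpow_of_ceil_pow_le {x : ℝ} {t ℓ : ℕ} (hx : 0 ≤ x) (ht : 1 ≤ t)
    (hℓ : ⌈x ^ t⌉₊ ≤ ℓ) : x ≤ (ℓ : ℝ) ^ (1 / (t : ℝ)) := by
  have h1 : x ^ t ≤ (ℓ : ℝ) := (Nat.le_ceil _).trans (by exact_mod_cast hℓ)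
  have ht0 : t ≠ 0 := by omega
  calc x = (x ^ t) ^ (1 / (t : ℝ)) := by rw [one_div, pow_rpow_inv_natCast hx ht0]
    _ ≤ (ℓ : ℝ) ^ (1 / (t : ℝ)) := rpow_le_rpow (pow_nonneg hx _) h1 (by positivity)

/-- `log (D + 1) ≤ t·x` when `0 ≤ D ≤ xᵗ`, `x ≥ 0`, `t ≥ 1` (`D + 1 ≤ (x + 1)ᵗ ≤ e^{tx}`).
[folklore] -/
theorem log_add_one_le {D x : ℝ} {t : ℕ} (hD0 : 0 ≤ D) (hx : 0 ≤ x) (ht : 1 ≤ t)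
    (hD : D ≤ x ^ t) : Real.log (D + 1) ≤ t * x := by
  have ht0 : t ≠ 0 := by omega
  have h1 : D + 1 ≤ Real.exp (t * x) := by
    calc D + 1 ≤ x ^ t + 1 ^ t := by rw [one_pow]; linarith
      _ ≤ (x + 1) ^ t := pow_add_pow_le hx zero_le_one ht0
      _ ≤ Real.exp x ^ t := pow_le_pow_left₀ (by positivity) (add_one_le_exp x) t
      _ = Real.exp (t * x) := (exp_nat_mul x t).symm
  calc Real.log (D + 1) ≤ Real.log (Real.exp (t * x)) := log_le_log (by positivity) h1
    _ = t * x := log_exp _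

/-- The exponent of the transfer `C⁺` is at most half of `(Δ h(𝔭) + λ Y deg 𝔭)/A`, by the choice
of `ℓ` (`2 A C c₁ ≤ ℓ^{1/t}`) and of the boost `λ ≥ 2 A C' (t+2) c₁ (L+1)`. [folklore] -/
theorem transfer_exponent_le {Cs C' A c₁ Δ Y L lam q h D δ : ℝ} {t : ℕ}
    (hCs : 0 < Cs) (hC' : 0 < C') (hA : 0 < A) (hc₁ : 1 ≤ c₁) (hΔ : 1 ≤ Δ) (hΔY : Δ ≤ Y)
    (hL : 0 ≤ L) (hh : 0 ≤ h) (hD : 0 ≤ D) (hδ : δ ≤ c₁ * Δ)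
    (hlog : Real.log (D + 1) ≤ t * (c₁ * Δ))
    (hq : 2 * A * Cs * c₁ ≤ q) (hlam : 2 * A * C' * ((t + 2) * c₁) * (L + 1) ≤ lam) :
    Cs * δ * h / q + C' * D * ((δ + 1) * (L + 1) + Real.log (D + 1)) ≤
      Δ * h / (2 * A) + lam * Y * D / (2 * A) := by
  have hq0 : 0 < q := lt_of_lt_of_le (by positivity) hq
  have hc₁0 : 0 < c₁ := by linarith
  have hc₁Δ : 1 ≤ c₁ * Δ := one_le_mul_of_one_le_of_one_le hc₁ hΔ
  have hY : 0 ≤ Y := by linarith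
  -- first term
  have h1 : Cs * δ * h / q ≤ Δ * h / (2 * A) := by
    have e1 : Cs * δ * h ≤ Cs * (c₁ * Δ) * h :=
      mul_le_mul_of_nonneg_right (mul_le_mul_of_nonneg_left hδ hCs.le) hh
    calc Cs * δ * h / q ≤ Cs * (c₁ * Δ) * h / q := div_le_div_of_nonneg_right e1 hq0.le
      _ ≤ Cs * (c₁ * Δ) * h / (2 * A * Cs * c₁) :=
          div_le_div_of_nonneg_left (by positivity) (by positivity) hq
      _ = Δ * h / (2 * A) := by field_simp
  -- second term
  have h2 : (δ + 1) * (L + 1) + Real.log (D + 1) ≤ (t + 2) * c₁ * (L + 1) * Y := by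
    have e1 : (δ + 1) * (L + 1) ≤ 2 * (c₁ * Δ) * (L + 1) :=
      mul_le_mul_of_nonneg_right (by linarith) (by linarith)
    have e2 : Real.log (D + 1) ≤ t * (c₁ * Δ) * (L + 1) :=
      hlog.trans (le_mul_of_one_le_right (by positivity) (by linarith))
    have e3 : (t + 2) * (c₁ * Δ) * (L + 1) ≤ (t + 2) * (c₁ * Y) * (L + 1) := by gcongr
    linarith
  have h3 : C' * D * ((δ + 1) * (L + 1) + Real.log (D + 1)) ≤ lam * Y * D / (2 * A) := by
    calc C' * D * ((δ + 1) * (L + 1) + Real.log (D + 1))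
        ≤ C' * D * ((t + 2) * c₁ * (L + 1) * Y) := mul_le_mul_of_nonneg_left h2 (by positivity)
      _ = (2 * A * C' * ((t + 2) * c₁) * (L + 1)) * (Y * D) / (2 * A) := by field_simp
      _ ≤ lam * (Y * D) / (2 * A) :=
          div_le_div_of_nonneg_right (mul_le_mul_of_nonneg_right hlam (by positivity))
            (by positivity)
      _ = lam * Y * D / (2 * A) := by ring
  linarith

/-- Root extraction: `ρ^ℓ ≤ e^{−X/M}` gives `ρ ≤ e^{−X/(Mℓ)}` (`ρ ≥ 0`, `ℓ ≥ 1`, `M > 0`).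
[folklore] -/
theorem le_exp_of_pow_le {ρ X M : ℝ} {ℓ : ℕ} (hρ : 0 ≤ ρ) (hℓ : 1 ≤ ℓ) (hM : 0 < M)
    (h : ρ ^ ℓ ≤ Real.exp (-(X / M))) : ρ ≤ Real.exp (-(X / (M * ℓ))) := by
  have hℓ0 : ℓ ≠ 0 := by omega
  have hℓne : (ℓ : ℝ) ≠ 0 := by exact_mod_cast hℓ0
  have hMne : M ≠ 0 := hM.ne'
  have e : Real.exp (-(X / (M * ℓ))) ^ ℓ = Real.exp (-(X / M)) := by
    rw [← exp_nat_mul]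
    congr 1
    field_simp
  rw [← pow_le_pow_iff_left₀ hρ (exp_pos _).le hℓ0, e]
  exact h

/-- Accuracy bookkeeping: with `c ≥ 4M(c_d + 1)`, `c ≥ 4M log(2Θ²)` and `X ≥ c`,
`2Θ² e^{−X/(2M)} ≤ e^{−(c_d+1)X/c}` and `e^{−X/(2M)} Θ ≤ 1/2`. [folklore] -/
theorem accuracy_le {Θ X M c cd : ℝ} (hΘ : 1 ≤ Θ) (hM : 0 < M) (hcd : 0 ≤ cd)
    (hc1 : 4 * M * (cd + 1) ≤ c) (hc2 : 4 * M * Real.log (2 * Θ ^ 2) ≤ c) (hX : c ≤ X) :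
    2 * Θ ^ 2 * Real.exp (-(X / (2 * M))) ≤ Real.exp (-((cd + 1) * X / c)) ∧
      Real.exp (-(X / (2 * M))) * Θ ≤ 1 / 2 := by
  have hc0 : 0 < c := lt_of_lt_of_le (by positivity) hc1
  have hX0 : 0 < X := lt_of_lt_of_le hc0 hX
  have hΘ2 : 1 ≤ 2 * Θ ^ 2 := by nlinarith
  have h1 : (cd + 1) * X / c ≤ X / (4 * M) := by
    rw [div_le_div_iff₀ hc0 (by positivity)]
    nlinarith [mul_le_mul_of_nonneg_left hc1 hX0.le]
  have h2 : Real.log (2 * Θ ^ 2) ≤ X / (4 * M) := by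
    rw [le_div_iff₀ (by positivity)]
    nlinarith
  have h3 : X / (4 * M) - X / (2 * M) = -(X / (4 * M)) := by
    field_simp
    ring
  refine ⟨?_, ?_⟩
  · rw [← exp_log (by positivity : (0 : ℝ) < 2 * Θ ^ 2), ← exp_add, exp_le_exp]
    linarith
  · have h4 : Real.log (2 * Θ) ≤ X / (2 * M) := by
      have e1 : Real.log (2 * Θ) ≤ Real.log (2 * Θ ^ 2) :=
        log_le_log (by positivity) (by nlinarith)
      have e2 : X / (4 * M) ≤ X / (2 * M) :=
        div_le_div_of_nonneg_left hX0.le (by positivity) (by linarith)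
      linarith
    have h5 : Real.exp (-(X / (2 * M))) ≤ (2 * Θ)⁻¹ := by
      rw [← exp_log (by positivity : (0 : ℝ) < 2 * Θ), ← exp_neg, exp_le_exp]
      linarith
    calc Real.exp (-(X / (2 * M))) * Θ ≤ (2 * Θ)⁻¹ * Θ :=
          mul_le_mul_of_nonneg_right h5 (by positivity)
      _ = 1 / 2 := by field_simp

/-- Height budget: `h_K(b) ≤ h(𝔭) + c_d deg 𝔭 ≤ c₁λ Y Δᵗ⁻¹ + c_d (c₁Δ)ᵗ ≤ (c₁λ + c_d c₁ᵗ) Y Δᵗ⁻¹`.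
[folklore] -/
theorem height_budget_le {hb hp D c₁ cd lam Δ Y c : ℝ} {t : ℕ} (ht : 1 ≤ t)
    (hc₁ : 1 ≤ c₁) (hcd : 0 ≤ cd) (hΔ : 1 ≤ Δ) (hΔY : Δ ≤ Y)
    (h1 : hb ≤ hp + cd * D) (h2 : hp ≤ c₁ * (lam * Y) * Δ ^ (t - 1)) (h3 : D ≤ (c₁ * Δ) ^ t)
    (hc : c₁ * lam + cd * c₁ ^ t ≤ c) :
    hb ≤ c * Y * Δ ^ (t - 1) := by
  have hP : 0 ≤ Δ ^ (t - 1) := by positivity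
  have hY : 0 ≤ Y := by linarith
  have hpow : (c₁ * Δ) ^ t ≤ c₁ ^ t * (Y * Δ ^ (t - 1)) := by
    rw [mul_pow]
    refine mul_le_mul_of_nonneg_left ?_ (by positivity)
    calc Δ ^ t = Δ ^ (t - 1) * Δ := by rw [← pow_succ, Nat.sub_add_cancel ht]
      _ ≤ Δ ^ (t - 1) * Y := mul_le_mul_of_nonneg_left hΔY hP
      _ = Y * Δ ^ (t - 1) := mul_comm _ _
  calc hb ≤ hp + cd * D := h1
    _ ≤ c₁ * (lam * Y) * Δ ^ (t - 1) + cd * (c₁ ^ t * (Y * Δ ^ (t - 1))) :=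
        add_le_add h2 (mul_le_mul_of_nonneg_left (h3.trans hpow) hcd)
    _ = (c₁ * lam + cd * c₁ ^ t) * (Y * Δ ^ (t - 1)) := by ring
    _ ≤ c * (Y * Δ ^ (t - 1)) := mul_le_mul_of_nonneg_right hc (by positivity)
    _ = c * Y * Δ ^ (t - 1) := by ring

/-- **The per-scale good-orbit transfer (curried form of the stub).** For `ω ∈ ℂᵗ` and `c₁ ≥ 1`:
constants `c_d` (dictionary), `C, ℓ₀` (transfer); `ℓ = max(ℓ₀, 1, ⌈(2c₁²C)ᵗ⌉)` (the
`δ h(𝔭)/ℓ^{1/t}` tail is `≤ Δ h(𝔭)/(2c₁)`), then `C'(ℓ)`, the boost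
`λ = max(1, 2c₁²C'(t+2)(log(2+‖ω‖) + 1))` (the `deg 𝔭 · Δ` terms are `≤ λ Y deg 𝔭/(2c₁)`), then
`c = c₁ + (c₁λ + c_d c₁ᵗ) + 4M(c_d+1) + 4M log(2Θ²)`, `M = c₁ℓ`, `Θ = ‖(1:ω)‖`. Given
`Y ≥ Δ ≥ c` and the prime `𝔭` with its four hypotheses: `SharpClosestPoint` with `δ = ⌊c₁Δ⌋`
yields a zero at projective distance `ρ ≤ exp(−(Δ h(𝔭) + Y deg 𝔭)/(2M))`;
`affine_near_of_projDist_le` and the dictionary give the point `(b₁/b₀, …, b_t/b₀) ∈ Kᵗ`, the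
embedding and the budgets. [cite: NesterenkoPhilippon2001, Ch. 3 Prop. 4.4 (p. 38); Ch. 4 §4 (p. 61)] -/
theorem pointDatum_of_clause_main (t : ℕ) (ht : 1 ≤ t) (hdict : ZeroDimDictionary)
    (hsharp : SharpClosestPoint) (ω : Fin t → ℂ) (c₁ : ℝ) (hc₁ : 1 ≤ c₁) :
    ∃ lam : ℝ, 1 ≤ lam ∧ ∃ c : ℝ, c₁ ≤ c ∧ ∀ Δ Y : ℝ, c ≤ Δ → Δ ≤ Y →
      ∀ 𝔭 : Ideal (Rx t), 𝔭.IsPrime → 𝔭.IsHomogeneous (homogeneousSubmodule (Fin (t + 1)) ℚ) →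
        IsUnmixedOfRank 𝔭 1 → (ideg 𝔭 1 : ℝ) ≤ (c₁ * Δ) ^ t →
        iheight 𝔭 1 ≤ c₁ * (lam * Y) * Δ ^ (t - 1) →
        iabs 𝔭 1 (Fin.cons 1 ω) ≤ Real.exp (-((Δ * iheight 𝔭 1 + lam * Y * ideg 𝔭 1) / c₁)) →
        Module.finrank ℚ ↥(homogeneousSubmodule (Fin (t + 1)) ℚ ⌊c₁ * Δ⌋₊) =
          Module.finrank ℚ ↥(homogeneousSubmodule (Fin (t + 1)) ℚ ⌊c₁ * Δ⌋₊ ⊓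
            𝔭.restrictScalars ℚ) + ideg 𝔭 1 →
        ∃ (K : Type) (_ : Field K) (_ : NumberField K) (β : Fin t → K) (σ : K →+* ℂ),
          (Module.finrank ℚ K : ℝ) ≤ (c * Δ) ^ t ∧
          Height.logHeight (Fin.cons (1 : K) β : Fin (t + 1) → K) ≤ c * Y * Δ ^ (t - 1) ∧
          ‖(fun j => σ (β j)) - ω‖ ≤
            Real.exp (-((Δ * Height.logHeight (Fin.cons (1 : K) β : Fin (t + 1) → K) +
              Y * Module.finrank ℚ K) / c)) := by
  classical
  -- constants attached to `t`, `ω` and `c₁`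
  obtain ⟨cd, hcd, hdict⟩ := hdict t ht
  obtain ⟨Cs, hCs, ℓ₀, hsharp⟩ := hsharp t ht
  have hc₁0 : 0 < c₁ := lt_of_lt_of_le one_pos hc₁
  set ω₁ : Fin (t + 1) → ℂ := Fin.cons 1 ω with hω₁def
  set Θ : ℝ := ‖ω₁‖ with hΘdef
  have hΘ : 1 ≤ Θ := one_le_norm_cons_one ω
  set L : ℝ := Real.log (2 + ‖ω‖) with hLdef
  have hL : 0 ≤ L := Real.log_nonneg (by linarith [norm_nonneg ω])
  set ℓ : ℕ := max ℓ₀ (max 1 ⌈(2 * c₁ * Cs * c₁) ^ t⌉₊) with hℓdef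
  have hℓ1 : 1 ≤ ℓ := le_trans (le_max_left _ _) (le_max_right _ _)
  have hℓceil : ⌈(2 * c₁ * Cs * c₁) ^ t⌉₊ ≤ ℓ := le_trans (le_max_right _ _) (le_max_right _ _)
  obtain ⟨C', hC', hsharp⟩ := hsharp ℓ (le_max_left _ _)
  set lam : ℝ := max 1 (2 * c₁ * C' * ((t + 2) * c₁) * (L + 1)) with hlamdef
  have hlam1 : 1 ≤ lam := le_max_left _ _
  set M : ℝ := c₁ * ℓ with hMdef
  have hM : 0 < M := by positivity
  have hlog0 : 0 ≤ Real.log (2 * Θ ^ 2) := Real.log_nonneg (by nlinarith)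
  -- the constant of the datum at `ω`
  set c : ℝ := c₁ + (c₁ * lam + cd * c₁ ^ t) + 4 * M * (cd + 1) + 4 * M * Real.log (2 * Θ ^ 2)
    with hcdef
  have n2 : 0 ≤ c₁ * lam + cd * c₁ ^ t := by positivity
  have n3 : 0 ≤ 4 * M * (cd + 1) := by positivity
  have n4 : 0 ≤ 4 * M * Real.log (2 * Θ ^ 2) := by positivity
  have hc_h : c₁ * lam + cd * c₁ ^ t ≤ c := by linarith
  have hc_a1 : 4 * M * (cd + 1) ≤ c := by linarith
  have hc_a2 : 4 * M * Real.log (2 * Θ ^ 2) ≤ c := by linarith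
  have hcc₁ : c₁ ≤ c := by linarith
  have hc1 : 1 ≤ c := hc₁.trans hcc₁
  have hc0 : 0 < c := lt_of_lt_of_le one_pos hc1
  refine ⟨lam, hlam1, c, hcc₁, fun Δ Y hΔ hY 𝔭 h𝔭prime h𝔭hom h𝔭unm hdeg hh𝔭 habs hclause => ?_⟩
  have hΔ1 : 1 ≤ Δ := hc1.trans hΔ
  have hΔ0 : 0 ≤ Δ := by linarith
  have hY0 : 0 ≤ Y := by linarith
  have hh𝔭0 : 0 ≤ iheight 𝔭 1 := height_nonneg _
  have hD1 : (1 : ℝ) ≤ ideg 𝔭 1 := by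
    exact_mod_cast Literature.Barriers.Schanuel.one_le_ideg_of_isPrime
      NesterenkoPhilippon2001_ch3_prop_4_4_holds le_rfl ht h𝔭prime h𝔭hom h𝔭unm
  -- the transfer `C⁺` at `δ = ⌊c₁Δ⌋`
  obtain ⟨β, hβ, hρℓ⟩ := hsharp 𝔭 ⌊c₁ * Δ⌋₊ ω h𝔭prime h𝔭hom h𝔭unm hclause
  set ρ : ℝ := projDist ω₁ β with hρdef
  have hρ0 : 0 ≤ ρ := projDist_nonneg _ _
  set X : ℝ := Δ * iheight 𝔭 1 + Y * ideg 𝔭 1 with hXdef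
  have hXc : c ≤ X := by
    have e1 : Y ≤ Y * ideg 𝔭 1 := le_mul_of_one_le_right hY0 hD1
    have e2 : 0 ≤ Δ * iheight 𝔭 1 := by positivity
    linarith
  have hρA : ρ ^ ℓ ≤ Real.exp (-(X / (2 * c₁))) := by
    have hδ : (⌊c₁ * Δ⌋₊ : ℝ) ≤ c₁ * Δ := Nat.floor_le (by positivity)
    have hq : 2 * c₁ * Cs * c₁ ≤ (ℓ : ℝ) ^ (1 / (t : ℝ)) :=
      le_rpow_of_ceil_pow_le (by positivity) ht hℓceil
    have hE := transfer_exponent_le (A := c₁) (h := iheight 𝔭 1) (D := (ideg 𝔭 1 : ℝ)) (Y := Y)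
      (lam := lam) hCs hC' hc₁0 hc₁ hΔ1 hY hL hh𝔭0 (Nat.cast_nonneg _) hδ
      (log_add_one_le (Nat.cast_nonneg _) (by positivity) ht hdeg) hq (le_max_right _ _)
    refine hρℓ.trans ?_
    calc iabs 𝔭 1 ω₁ * Real.exp (Cs * ⌊c₁ * Δ⌋₊ * iheight 𝔭 1 / (ℓ : ℝ) ^ (1 / (t : ℝ)) +
          C' * ideg 𝔭 1 * ((⌊c₁ * Δ⌋₊ + 1) * (L + 1) + Real.log ((ideg 𝔭 1 : ℝ) + 1)))
        ≤ Real.exp (-((Δ * iheight 𝔭 1 + lam * Y * ideg 𝔭 1) / c₁)) *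
            Real.exp (Δ * iheight 𝔭 1 / (2 * c₁) + lam * Y * ideg 𝔭 1 / (2 * c₁)) :=
          mul_le_mul habs (exp_le_exp.mpr hE) (exp_pos _).le (exp_pos _).le
      _ = Real.exp (-((Δ * iheight 𝔭 1 + lam * Y * ideg 𝔭 1) / (2 * c₁))) := by
          rw [← exp_add]
          congr 1
          field_simp
          ring
      _ ≤ Real.exp (-(X / (2 * c₁))) := by
          rw [exp_le_exp, neg_le_neg_iff, hXdef]
          refine div_le_div_of_nonneg_right ?_ (by positivity)
          have : Y * ideg 𝔭 1 ≤ lam * Y * ideg 𝔭 1 := by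
            rw [mul_assoc]
            exact le_mul_of_one_le_left (by positivity) hlam1
          linarith
  have hρM : ρ ≤ Real.exp (-(X / (2 * M))) := by
    have := le_exp_of_pow_le hρ0 hℓ1 (by positivity) hρA
    have e : 2 * c₁ * (ℓ : ℝ) = 2 * M := by rw [hMdef]; ring
    rwa [e] at this
  obtain ⟨hacc, hhalf⟩ := accuracy_le hΘ hM hcd.le hc_a1 hc_a2 hXc
  -- the close zero is affine-near
  obtain ⟨hβ0, -, hnear⟩ :=
    affine_near_of_projDist_le ω hβ.1 ((mul_le_mul_of_nonneg_right hρM (by positivity)).trans hhalf)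
  -- the dictionary: `β = l · σ(b)`, `K = ℚ(b)`, output point `b' = (b₁/b₀, …, b_t/b₀)`
  obtain ⟨K, _instF, _instNF, b, -, hzeros, -, hfin, hhb, -, -⟩ := hdict 𝔭 h𝔭prime h𝔭hom h𝔭unm
  obtain ⟨-, σ, l, hβeq⟩ := (hzeros β).mp hβ
  have hβ0' : β 0 = l * σ (b 0) := by rw [hβeq]
  have hl : l ≠ 0 := fun h => hβ0 (by rw [hβ0', h, zero_mul])
  have hb00 : b 0 ≠ 0 := fun h => hβ0 (by rw [hβ0', h, map_zero, mul_zero])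
  set b' : Fin t → K := fun j => b j.succ / b 0 with hb'def
  have hσb' : ∀ j : Fin t, σ (b' j) = β j.succ / β 0 := by
    intro j
    have e1 : β j.succ = l * σ (b j.succ) := by rw [hβeq]
    rw [hb'def, map_div₀, e1, hβ0', mul_div_mul_left _ _ hl]
  have hcons : (Fin.cons (1 : K) b' : Fin (t + 1) → K) = (b 0)⁻¹ • b := by
    funext i
    refine Fin.cases ?_ (fun j => ?_) i
    · simp [hb00]
    · simp [hb'def, div_eq_inv_mul]
  have hheight : Height.logHeight (Fin.cons (1 : K) b' : Fin (t + 1) → K) = Height.logHeight b := by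
    rw [hcons, Height.logHeight_smul_eq_logHeight _ (inv_ne_zero hb00)]
  have hfinR : (Module.finrank ℚ K : ℝ) = ideg 𝔭 1 := by exact_mod_cast hfin
  refine ⟨K, _instF, _instNF, b', σ, ?_, ?_, ?_⟩
  · -- degree budget
    rw [hfinR]
    exact hdeg.trans (pow_le_pow_left₀ (by positivity) (mul_le_mul_of_nonneg_right hcc₁ hΔ0) t)
  · -- height budget
    rw [hheight]
    exact height_budget_le ht hc₁ hcd.le hΔ1 hY hhb hh𝔭 hdeg hc_h
  · -- accuracy
    rw [hheight, hfinR]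
    have hsup : ‖(fun j => σ (b' j)) - ω‖ ≤ 2 * Θ ^ 2 * ρ := by
      refine (pi_norm_le_iff_of_nonneg (by positivity)).mpr fun j => ?_
      simp only [Pi.sub_apply, hσb']
      exact hnear j
    have hnum : Δ * Height.logHeight b + Y * ideg 𝔭 1 ≤ (cd + 1) * X := by
      have e1 : Δ * Height.logHeight b ≤ Δ * (iheight 𝔭 1 + cd * ideg 𝔭 1) :=
        mul_le_mul_of_nonneg_left hhb hΔ0
      have e2 : Δ * (cd * ideg 𝔭 1) ≤ Y * (cd * ideg 𝔭 1) :=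
        mul_le_mul_of_nonneg_right hY (by positivity)
      have e3 : 0 ≤ cd * (Δ * iheight 𝔭 1) := by positivity
      rw [hXdef]
      linarith
    calc ‖(fun j => σ (b' j)) - ω‖ ≤ 2 * Θ ^ 2 * ρ := hsup
      _ ≤ 2 * Θ ^ 2 * Real.exp (-(X / (2 * M))) := mul_le_mul_of_nonneg_left hρM (by positivity)
      _ ≤ Real.exp (-((cd + 1) * X / c)) := hacc
      _ ≤ Real.exp (-((Δ * Height.logHeight b + Y * ideg 𝔭 1) / c)) := by
          rw [exp_le_exp, neg_le_neg_iff]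
          exact div_le_div_of_nonneg_right hnum hc0.le

end PointDatum

/-- **Stub `pointDatum_of_clause` — the per-scale good-orbit transfer (any `t ≥ 1`):
`ZeroDimDictionary → SharpClosestPoint →` for every `ω ∈ ℂᵗ`, `c₁ ≥ 1` there are `λ ≥ 1`, `c ≥ c₁`
such that for `Y ≥ Δ ≥ c`, ONE homogeneous prime `𝔭` of rank `1` with the 0-cycle bounds at the
boosted scale `(Δ, λY)` and the interpolation clause at level `⌊c₁Δ⌋` yields a
`PointAPAbsAt t`-datum at `(Δ, Y)`.** Short wrapper around
`PointDatum.pointDatum_of_clause_main` (transfer `C⁺` at `δ = ⌊c₁Δ⌋`, projective-to-affine chart,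
0-dimensional dictionary, budgets).
[cite: NesterenkoPhilippon2001, Ch. 3 Prop. 4.4 (p. 38); Ch. 4 §4 (p. 61)] -/
theorem pointDatum_of_clause : ∀ t : ℕ, 1 ≤ t → ZeroDimDictionary → SharpClosestPoint → ∀ (ω : Fin t → ℂ) (c₁ : ℝ), 1 ≤ c₁ → ∃ lam : ℝ, 1 ≤ lam ∧ ∃ c : ℝ, c₁ ≤ c ∧ ∀ Δ Y : ℝ, c ≤ Δ → Δ ≤ Y → ∀ 𝔭 : Ideal (Rx t), 𝔭.IsPrime → 𝔭.IsHomogeneous (homogeneousSubmodule (Fin (t + 1)) ℚ) → IsUnmixedOfRank 𝔭 1 → (ideg 𝔭 1 : ℝ) ≤ (c₁ * Δ) ^ t → iheight 𝔭 1 ≤ c₁ * (lam * Y) * Δ ^ (t - 1) → iabs 𝔭 1 (Fin.cons 1 ω) ≤ Real.exp (-((Δ * iheight 𝔭 1 + lam * Y * ideg 𝔭 1) / c₁)) → Module.finrank ℚ ↥(homogeneousSubmodule (Fin (t + 1)) ℚ ⌊c₁ * Δ⌋₊) = Module.finrank ℚ ↥(homogeneousSubmodule (Fin (t + 1)) ℚ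 ⌊c₁ * Δ⌋₊ ⊓ 𝔭.restrictScalars ℚ) + ideg 𝔭 1 → ∃ (K : Type) (_ : Field K) (_ : NumberField K) (β : Fin t → K) (σ : K →+* ℂ), (Module.finrank ℚ K : ℝ) ≤ (c * Δ) ^ t ∧ Height.logHeight (Fin.cons (1 : K) β : Fin (t + 1) → K) ≤ c * Y * Δ ^ (t - 1) ∧ ‖(fun j => σ (β j)) - ω‖ ≤ Real.exp (-((Δ * Height.logHeight (Fin.cons (1 : K) β : Fin (t + 1) → K) + Y * Module.finrank ℚ K) / c)) := by
  intro t ht hdict hsharp ω c₁ hc₁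
  exact PointDatum.pointDatum_of_clause_main t ht hdict hsharp ω c₁ hc₁

end Summit.Schanuel.Schanuel.Cruxes.ApproximationProperty.OrbitInterpolationDeterminant

end
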